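import Mathlib
import HarnessLib

/-!
# Square roots of positive integers with pairwise non-square ratios are linearly independent over `ℚ` (Besicovitch 1940), by Galois theory
# on the multiquadratic field `ℚ(√a : a ∈ D)` — the arithmetic input of the trace test for TOWERS of CM elliptic curves of distinct fields

Theorems only, no definition, no named fact.  Folklore algebra (A. S. Besicovitch, *On the linear independence of fractional powers of
integers*, J. London Math. Soc. 15 (1940) 3–6, the case of square roots), generalising the three-root lemma of the Summits-side `CorCM/MumfordTateRankThreeSquareRoots`
to any finite family, in the shape produced by the COR-CM Mumford–Tate-rank ladder's field hypotheses (`a ≠ s²b` for all rational `s`, from «no ring homomorphism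
between the CM fields `ℚ(√−a)`, `ℚ(√−b)`»).

PROOF (Galois signs, no degree computation).  Let `L = ℚ(√a : a ∈ D) ⊆ ℝ`, the field generated by the roots of `∏_{a ∈ D}(X² − a)`; it is a
splitting field, hence finite Galois over `ℚ` (§1), and every `σ ∈ Gal(L/ℚ)` acts on each `√a` by a sign `ε_a(σ) = ±1`.  Given a relation
`Σ_{a ∈ D} c_a √a = 0` with all `c_a ≠ 0` and `|D| ≥ 2`, pick `a₀ ≠ a₁` in `D`: `√a₀ √a₁ = √(a₀a₁)` is irrational (the ratio `a₀/a₁` is not a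
square), so some `σ` moves it (`IsGalois.mem_bot_iff_fixed`), i.e. `ε_{a₀}(σ) ≠ ε_{a₁}(σ)`.  Adding `σ` of the relation to the relation kills the
terms with `ε_a = −1` and doubles the others: `Σ_{ε_a = 1} c_a √a = 0`, a relation on a PROPER non-empty subfamily — contradiction by induction
on `|D|` (§2, `Finset.strongInduction`).

* §1 `splits_map_prod_X_sq_sub_C`, `sqrt_mem_adjoin_rootSet_prod`, `isGalois_adjoin_rootSet_prod_X_sq_sub_C` (with finite dimension),
  `coe_algEquiv_sqrt_eq_or_eq_neg` (`σ√a = ±√a`).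
* §2 **`eq_zero_of_sum_ratCast_mul_sqrt_eq_zero`** — `D ⊆ ℕ_{>0}` finite with `a ≠ s²b` (`a ≠ b` in `D`, `s ∈ ℚ`), `Σ_{a ∈ D} c_a √a = 0` in `ℝ`
  with `c_a ∈ ℚ` ⟹ `c_a = 0` for all `a ∈ D`; **`eq_zero_of_sum_ratCast_mul_sqrt_eq_zero_family`** — the same for a family `d : ι → ℕ`
  indexed by a finite type (pairwise non-square ratios), and `…_family_complex` (the relation read in `ℂ`).

## References
* [Besicovitch1940] A. S. Besicovitch, *On the linear independence of fractional powers of integers*, J. London Math. Soc. 15 (1940) 3–6, Thm. 1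
  (square roots: Cor.). [cite: Besicovitch1940, Thm. 1]
* [Lang2002] S. Lang, *Algebra*, 3rd ed., VI §1 Thm. 1.8 (Galois correspondence; fixed field of the whole group), VI §8 (Kummer / multiquadratic
  extensions). [cite: Lang2002, VI §1 Thm. 1.8]
* [MoonenZarhin1999LowDim] B. Moonen, Yu. G. Zarhin, *Hodge classes on abelian varieties of low dimension*, Math. Ann. 315 (1999), §3 Prop. (3.8)
  [corpus: paper:arxiv-math_9901113 p. 7]. [cite: MoonenZarhin1999LowDim, §3 Prop. (3.8)]

Provenance: Literature home (family `hodge`) of the Summits-side `CorCM/MumfordTateRankSquareRootsIndependent` (cell `pub-hodgecm2` ∕ `pub-hodge-ring2`; all its imports are `Literature/` and Mathlib), which `Literature/` may not import; theorems only, no named fact, no definition. Nothing here bears on `HC_CM`; no case of the Hodge conjecture beyond the stated unconditional ones is claimed. Lane `lit-hodgefound` (Layer A2/A3: polarizations, CM types, reflex fields, Hodge and Mumford–Tate groups), seat p20.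
-/

noncomputable section

open Polynomial IntermediateField
open scoped BigOperators

namespace Literature.NumberTheory.SquareRootsIndependent

/-! ## §1 The multiquadratic field `ℚ(√a : a ∈ D) ⊆ ℝ` -/

/-- `∏_{b ∈ D} (X² − b) ≠ 0` in `ℚ[X]`. [cite: Besicovitch1940, Thm. 2] -/
theorem prod_X_sq_sub_C_ne_zero (D : Finset ℕ) : (∏ b ∈ D, (X ^ 2 - C (b : ℚ)) : ℚ[X]) ≠ 0 :=
  Finset.prod_ne_zero_iff.2 fun b _ => X_pow_sub_C_ne_zero (by norm_num) _

/-- `∏_{b ∈ D} (X² − b)` splits over `ℝ`: `X² − b = (X − √b)(X + √b)`. [cite: Besicovitch1940, Thm. 2] -/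
theorem splits_map_prod_X_sq_sub_C (D : Finset ℕ) :
    (((∏ b ∈ D, (X ^ 2 - C (b : ℚ)) : ℚ[X])).map (algebraMap ℚ ℝ)).Splits := by
  rw [Polynomial.map_prod]
  refine Splits.prod fun b _ => ?_
  have h : ((X ^ 2 - C (b : ℚ) : ℚ[X])).map (algebraMap ℚ ℝ) = (X - C (Real.sqrt b)) * (X + C (Real.sqrt b)) := by
    have hb : (algebraMap ℚ ℝ) (b : ℚ) = Real.sqrt b * Real.sqrt b := by
      rw [map_natCast, Real.mul_self_sqrt (Nat.cast_nonneg b)]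
    rw [Polynomial.map_sub, Polynomial.map_pow, map_X, map_C, hb, map_mul]
    ring
  rw [h]
  exact (Splits.X_sub_C _).mul (Splits.X_add_C _)

/-- `√a ∈ ℚ(√b : b ∈ D)` for `a ∈ D` (`√a` is a root of `∏ (X² − b)`). [cite: Besicovitch1940, Thm. 2] -/
theorem sqrt_mem_adjoin_rootSet_prod {D : Finset ℕ} {a : ℕ} (ha : a ∈ D) :
    Real.sqrt a ∈ adjoin ℚ (((∏ b ∈ D, (X ^ 2 - C (b : ℚ)) : ℚ[X])).rootSet ℝ) := by
  refine subset_adjoin ℚ _ ?_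
  rw [mem_rootSet]
  refine ⟨prod_X_sq_sub_C_ne_zero D, ?_⟩
  rw [map_prod]
  exact Finset.prod_eq_zero ha (by simp [Real.sq_sqrt (Nat.cast_nonneg a)])

/-- **`ℚ(√b : b ∈ D)` is a finite Galois extension of `ℚ`** (the splitting field of `∏ (X² − b)`; characteristic zero).
[cite: Lang2002, VI §1 Thm. 1.8] -/
theorem isGalois_adjoin_rootSet_prod_X_sq_sub_C (D : Finset ℕ) :
    IsGalois ℚ (adjoin ℚ (((∏ b ∈ D, (X ^ 2 - C (b : ℚ)) : ℚ[X])).rootSet ℝ)) ∧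
      FiniteDimensional ℚ (adjoin ℚ (((∏ b ∈ D, (X ^ 2 - C (b : ℚ)) : ℚ[X])).rootSet ℝ)) := by
  set p : ℚ[X] := ∏ b ∈ D, (X ^ 2 - C (b : ℚ)) with hp
  haveI : p.IsSplittingField ℚ (adjoin ℚ (p.rootSet ℝ)) :=
    IntermediateField.adjoin_rootSet_isSplittingField (splits_map_prod_X_sq_sub_C D)
  haveI : FiniteDimensional ℚ (adjoin ℚ (p.rootSet ℝ)) := Polynomial.IsSplittingField.finiteDimensional _ p
  haveI : Normal ℚ (adjoin ℚ (p.rootSet ℝ)) := Normal.of_isSplittingField p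
  exact ⟨isGalois_iff.2 ⟨inferInstance, inferInstance⟩, inferInstance⟩

/-- **A `ℚ`-automorphism of `ℚ(√b : b ∈ D)` sends `√a` to `±√a`** (`(σ√a)² = a`). [cite: Lang2002, VI §8] -/
theorem coe_algEquiv_sqrt_eq_or_eq_neg {D : Finset ℕ}
    (σ : adjoin ℚ (((∏ b ∈ D, (X ^ 2 - C (b : ℚ)) : ℚ[X])).rootSet ℝ) ≃ₐ[ℚ] adjoin ℚ (((∏ b ∈ D, (X ^ 2 - C (b : ℚ)) : ℚ[X])).rootSet ℝ))
    {a : ℕ} (ha : a ∈ D) :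
    ((σ ⟨Real.sqrt a, sqrt_mem_adjoin_rootSet_prod ha⟩ : adjoin ℚ (((∏ b ∈ D, (X ^ 2 - C (b : ℚ)) : ℚ[X])).rootSet ℝ)) : ℝ) = Real.sqrt a ∨
      ((σ ⟨Real.sqrt a, sqrt_mem_adjoin_rootSet_prod ha⟩ : adjoin ℚ (((∏ b ∈ D, (X ^ 2 - C (b : ℚ)) : ℚ[X])).rootSet ℝ)) : ℝ) = -Real.sqrt a := by
  -- work through the embedding `val : L → ℝ`
  have hval : ∀ z : adjoin ℚ (((∏ b ∈ D, (X ^ 2 - C (b : ℚ)) : ℚ[X])).rootSet ℝ),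
      (z : ℝ) = (adjoin ℚ (((∏ b ∈ D, (X ^ 2 - C (b : ℚ)) : ℚ[X])).rootSet ℝ)).val z := fun z => rfl
  have hyy : (⟨Real.sqrt a, sqrt_mem_adjoin_rootSet_prod ha⟩ : adjoin ℚ (((∏ b ∈ D, (X ^ 2 - C (b : ℚ)) : ℚ[X])).rootSet ℝ)) *
      ⟨Real.sqrt a, sqrt_mem_adjoin_rootSet_prod ha⟩ = ((a : ℚ) : adjoin ℚ (((∏ b ∈ D, (X ^ 2 - C (b : ℚ)) : ℚ[X])).rootSet ℝ)) := by
    apply (adjoin ℚ (((∏ b ∈ D, (X ^ 2 - C (b : ℚ)) : ℚ[X])).rootSet ℝ)).val.toRingHom.injective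
    rw [AlgHom.toRingHom_eq_coe, RingHom.coe_coe, map_mul, map_ratCast, ← hval, Rat.cast_natCast]
    exact Real.mul_self_sqrt (Nat.cast_nonneg a)
  have hσ : (adjoin ℚ (((∏ b ∈ D, (X ^ 2 - C (b : ℚ)) : ℚ[X])).rootSet ℝ)).val (σ ⟨Real.sqrt a, sqrt_mem_adjoin_rootSet_prod ha⟩) *
      (adjoin ℚ (((∏ b ∈ D, (X ^ 2 - C (b : ℚ)) : ℚ[X])).rootSet ℝ)).val (σ ⟨Real.sqrt a, sqrt_mem_adjoin_rootSet_prod ha⟩) =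
      Real.sqrt a * Real.sqrt a := by
    rw [← map_mul, ← map_mul, hyy, map_ratCast, map_ratCast, Rat.cast_natCast, Real.mul_self_sqrt (Nat.cast_nonneg a)]
  exact mul_self_eq_mul_self_iff.1 hσ

/-! ## §2 Linear independence of `√a`, `a ∈ D` -/

/-- **Besicovitch for square roots: `Σ_{a ∈ D} c_a √a = 0` with rational `c_a`, over a finite set `D` of positive integers whose pairwise
ratios are not rational squares, forces `c_a = 0` for every `a ∈ D`.** [cite: Besicovitch1940, Thm. 1] [cite: Lang2002, VI §1 Thm. 1.8] -/
theorem eq_zero_of_sum_ratCast_mul_sqrt_eq_zero (D : Finset ℕ) (hpos : ∀ a ∈ D, 0 < a)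
    (hD : ∀ a ∈ D, ∀ b ∈ D, a ≠ b → ∀ s : ℚ, (a : ℚ) ≠ s ^ 2 * b) (c : ℕ → ℚ)
    (h : ∑ a ∈ D, (c a : ℝ) * Real.sqrt a = 0) : ∀ a ∈ D, c a = 0 := by
  classical
  induction D using Finset.strongInduction generalizing c with
  | H D ih =>
  -- (1) if some coefficient vanishes, drop it and use the induction hypothesis
  by_cases hall : ∀ a ∈ D, c a ≠ 0
  swap
  · push Not at hall
    obtain ⟨a₀, ha₀, hc₀⟩ := hall
    have hsub : D.erase a₀ ⊂ D := Finset.erase_ssubset ha₀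
    have h' : ∑ a ∈ D.erase a₀, (c a : ℝ) * Real.sqrt a = 0 := by
      rw [← Finset.add_sum_erase D _ ha₀, hc₀, Rat.cast_zero, zero_mul, zero_add] at h
      exact h
    intro a ha
    by_cases haa : a = a₀
    · rw [haa, hc₀]
    · exact ih _ hsub (fun b hb => hpos b (Finset.mem_of_mem_erase hb))
        (fun b hb b' hb' => hD b (Finset.mem_of_mem_erase hb) b' (Finset.mem_of_mem_erase hb')) c h' a (Finset.mem_erase.2 ⟨haa, ha⟩)
  -- (2) all coefficients non-zero: `D` is empty, a singleton (impossible), or has two elements `a₀ ≠ a₁`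
  rcases D.eq_empty_or_nonempty with hDe | ⟨a₀, ha₀⟩
  · simp [hDe]
  exfalso
  by_cases hsing : ∀ a ∈ D, a = a₀
  · -- `D = {a₀}`: `c_{a₀} √a₀ = 0`
    have hD1 : D = {a₀} := Finset.eq_singleton_iff_unique_mem.2 ⟨ha₀, hsing⟩
    rw [hD1, Finset.sum_singleton] at h
    rcases mul_eq_zero.1 h with h0 | h0
    · exact hall a₀ ha₀ (by exact_mod_cast h0)
    · exact (Real.sqrt_pos.2 (Nat.cast_pos.2 (hpos a₀ ha₀))).ne' h0
  push Not at hsing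
  obtain ⟨a₁, ha₁, h10⟩ := hsing
  -- the Galois group of `L = ℚ(√a : a ∈ D)` and the signs `ε_a(σ)`
  obtain ⟨hGal, hfin⟩ := isGalois_adjoin_rootSet_prod_X_sq_sub_C D
  -- the elements `√a ∈ L = ℚ(√a : a ∈ D)` and the embedding `val : L → ℝ`
  let L := adjoin ℚ (((∏ b ∈ D, (X ^ 2 - C (b : ℚ)) : ℚ[X])).rootSet ℝ)
  have hval : ∀ z : L, (z : ℝ) = L.val z := fun z => rfl
  let r : D → L := fun a => ⟨Real.sqrt (a : ℕ), sqrt_mem_adjoin_rootSet_prod a.2⟩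
  have hr : ∀ a : D, L.val (r a) = Real.sqrt (a : ℕ) := fun a => rfl
  have hr' : ∀ a (ha : a ∈ D), L.val (r ⟨a, ha⟩) = Real.sqrt a := fun a ha => rfl
  -- `θ = √a₀ √a₁` is irrational, hence moved by some `σ`
  have hθ : ¬ ∀ σ : L ≃ₐ[ℚ] L, σ (r ⟨a₀, ha₀⟩ * r ⟨a₁, ha₁⟩) = r ⟨a₀, ha₀⟩ * r ⟨a₁, ha₁⟩ := by
    intro hfix
    have hmem := (IsGalois.mem_bot_iff_fixed (r ⟨a₀, ha₀⟩ * r ⟨a₁, ha₁⟩)).2 hfix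
    rw [IntermediateField.mem_bot] at hmem
    obtain ⟨q, hq⟩ := hmem
    have hqR : (q : ℝ) = Real.sqrt a₀ * Real.sqrt a₁ := by
      have h1 := congrArg (fun z => L.val z) hq
      simp only [map_mul, hr'] at h1
      rw [eq_ratCast (algebraMap ℚ L), map_ratCast] at h1
      exact h1
    -- `a₀ a₁ = q²`, so `a₁ = (q / a₀)² a₀`
    have hsq : (q : ℝ) ^ 2 = (a₀ : ℝ) * a₁ := by
      rw [hqR, mul_pow, Real.sq_sqrt (Nat.cast_nonneg a₀), Real.sq_sqrt (Nat.cast_nonneg a₁)]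
    have hsqQ : (q : ℚ) ^ 2 = (a₀ : ℚ) * a₁ := by exact_mod_cast hsq
    have ha₀Q : (a₀ : ℚ) ≠ 0 := by exact_mod_cast (hpos a₀ ha₀).ne'
    refine hD a₁ ha₁ a₀ ha₀ h10 (q / a₀) ?_
    rw [div_pow, hsqQ]
    field_simp
  push Not at hθ
  obtain ⟨σ, hσ⟩ := hθ
  -- signs `ε_a(σ) = ±1`
  let ε : ℕ → ℚ := fun a => if ha : a ∈ D then (if L.val (σ (r ⟨a, ha⟩)) = Real.sqrt a then 1 else -1) else 1
  have hε : ∀ a (ha : a ∈ D), (ε a = 1 ∨ ε a = -1) ∧ L.val (σ (r ⟨a, ha⟩)) = ε a * Real.sqrt a := by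
    intro a ha
    by_cases h1 : L.val (σ (r ⟨a, ha⟩)) = Real.sqrt a
    · have h2 : ε a = 1 := by simp only [ε, dif_pos ha, if_pos h1]
      rw [h2, h1]
      exact ⟨Or.inl rfl, by simp⟩
    · have h2 : ε a = -1 := by simp only [ε, dif_pos ha, if_neg h1]
      rw [h2]
      refine ⟨Or.inr rfl, ?_⟩
      rcases coe_algEquiv_sqrt_eq_or_eq_neg σ ha with h3 | h3
      · exact absurd h3 h1
      · have h4 : L.val (σ (r ⟨a, ha⟩)) = -Real.sqrt a := h3
        rw [h4]
        simp
  have he' : ∀ a : D, L.val (σ (r a)) = ε a * Real.sqrt (a : ℕ) := fun a => (hε a a.2).2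
  have hε1 : ∀ a ∈ D, ε a = 1 ∨ ε a = -1 := fun a ha => (hε a ha).1
  -- `σ` applied to the relation: `Σ c_a ε_a √a = 0`
  let x : L := ∑ a : D, ((c a : ℚ) : L) * r a
  have hxval : L.val x = ∑ a ∈ D, (c a : ℝ) * Real.sqrt a := by
    simp only [x, map_sum, map_mul, map_ratCast, hr]
    exact Finset.sum_coe_sort D (fun a => (c a : ℝ) * Real.sqrt a)
  have hx0 : x = 0 := L.val.toRingHom.injective (by rw [AlgHom.toRingHom_eq_coe, RingHom.coe_coe, hxval, h, map_zero])
  have hσx : ∑ a ∈ D, (c a : ℝ) * (ε a * Real.sqrt a) = 0 := by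
    have h1 : L.val (σ x) = 0 := by rw [hx0, map_zero, map_zero]
    simp only [x, map_sum, map_mul, map_ratCast, he'] at h1
    rw [← h1]
    exact (Finset.sum_coe_sort D (fun a => (c a : ℝ) * (ε a * Real.sqrt a))).symm
  -- the relation on `D₊ = {a ∈ D : ε_a = 1}`: `Σ_{D₊} c_a √a = 0`
  set Dp := D.filter (fun a => ε a = 1) with hDp
  have hsum : ∑ a ∈ Dp, (c a : ℝ) * Real.sqrt a = 0 := by
    have h2 : ∑ a ∈ D, ((c a : ℝ) * Real.sqrt a + (c a : ℝ) * (ε a * Real.sqrt a)) = 0 := by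
      rw [Finset.sum_add_distrib, h, hσx, add_zero]
    rw [hDp, Finset.sum_filter]
    have h3 : ∑ a ∈ D, ((c a : ℝ) * Real.sqrt a + (c a : ℝ) * (ε a * Real.sqrt a)) =
        ∑ a ∈ D, 2 * (if ε a = 1 then (c a : ℝ) * Real.sqrt a else 0) := by
      refine Finset.sum_congr rfl fun a ha => ?_
      rcases hε1 a ha with h1 | h1
      · rw [if_pos h1, h1]; push_cast; ring
      · rw [if_neg (by rw [h1]; norm_num), h1]; push_cast; ring
    rw [h3, ← Finset.mul_sum] at h2
    simpa using h2
  -- `ε_{a₀} ≠ ε_{a₁}`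
  have hne : ε a₀ ≠ ε a₁ := by
    intro heq
    apply hσ
    apply L.val.toRingHom.injective
    simp only [AlgHom.toRingHom_eq_coe, RingHom.coe_coe, map_mul, (hε a₀ ha₀).2, (hε a₁ ha₁).2, hr', heq]
    rcases hε1 a₁ ha₁ with h1 | h1 <;> rw [h1] <;> push_cast <;> ring
  -- one of `a₀, a₁` has sign `+1`, the other `−1`; so `D₊` is a proper subset of `D` containing an index with `c ≠ 0`
  obtain ⟨bp, hbpD, hbp, bm, hbmD, hbm⟩ : ∃ bp ∈ D, ε bp = 1 ∧ ∃ bm ∈ D, ε bm = -1 := by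
    rcases hε1 a₀ ha₀ with h0 | h0 <;> rcases hε1 a₁ ha₁ with h1 | h1
    · exact absurd (h0.trans h1.symm) hne
    · exact ⟨a₀, ha₀, h0, a₁, ha₁, h1⟩
    · exact ⟨a₁, ha₁, h1, a₀, ha₀, h0⟩
    · exact absurd (h0.trans h1.symm) hne
  have hDpD : Dp ⊂ D := by
    refine ⟨Finset.filter_subset _ _, fun hle => ?_⟩
    have := (Finset.mem_filter.1 (hle hbmD)).2
    rw [hbm] at this
    norm_num at this
  have hzero := ih Dp hDpD (fun b hb => hpos b (Finset.filter_subset _ _ hb))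
    (fun b hb b' hb' => hD b (Finset.filter_subset _ _ hb) b' (Finset.filter_subset _ _ hb')) c hsum bp (Finset.mem_filter.2 ⟨hbpD, hbp⟩)
  exact hall bp hbpD hzero

/-- **Besicovitch for a finite family**: `d : ι → ℕ` positive with `d_j ≠ s² d_k` for `j ≠ k` and all rational `s`, `Σ_j c_j √(d_j) = 0` in `ℝ`
with rational `c_j` ⟹ all `c_j = 0`. [cite: Besicovitch1940, Thm. 1] -/
theorem eq_zero_of_sum_ratCast_mul_sqrt_eq_zero_family {ι : Type*} [Fintype ι] (d : ι → ℕ) (hpos : ∀ j, 0 < d j)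
    (hd : ∀ j k, j ≠ k → ∀ s : ℚ, (d j : ℚ) ≠ s ^ 2 * d k) (c : ι → ℚ) (h : ∑ j, (c j : ℝ) * Real.sqrt (d j) = 0) : ∀ j, c j = 0 := by
  classical
  -- `d` is injective (a ratio `1 = 1²` is a square)
  have hinj : Function.Injective d := fun j k hjk => by
    by_contra hne
    exact hd j k hne 1 (by rw [hjk]; ring)
  -- transport to the image finset
  set D := Finset.univ.image d with hDdef
  set c' : ℕ → ℚ := fun a => if h : ∃ j, d j = a then c h.choose else 0 with hc'
  have hc'd : ∀ j, c' (d j) = c j := fun j => by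
    have hex : ∃ k, d k = d j := ⟨j, rfl⟩
    rw [hc']
    simp only [hex, dif_pos]
    exact congrArg c (hinj hex.choose_spec)
  have hrel : ∑ a ∈ D, (c' a : ℝ) * Real.sqrt a = 0 := by
    rw [hDdef, Finset.sum_image (fun j _ k _ hjk => hinj hjk)]
    simpa only [hc'd] using h
  have hzero := eq_zero_of_sum_ratCast_mul_sqrt_eq_zero D
    (fun a ha => by obtain ⟨j, -, rfl⟩ := Finset.mem_image.1 ha; exact hpos j)
    (fun a ha b hb hab => by
      obtain ⟨j, -, rfl⟩ := Finset.mem_image.1 ha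
      obtain ⟨k, -, rfl⟩ := Finset.mem_image.1 hb
      exact hd j k (fun hjk => hab (congrArg d hjk)))
    c' hrel
  intro j
  rw [← hc'd j]
  exact hzero (d j) (Finset.mem_image.2 ⟨j, Finset.mem_univ _, rfl⟩)

/-- The complex reading: `Σ_j c_j √(d_j) = 0` in `ℂ` (rational `c_j`, real square roots) ⟹ all `c_j = 0`. [cite: Besicovitch1940, Thm. 1] -/
theorem eq_zero_of_sum_ratCast_mul_sqrt_eq_zero_family_complex {ι : Type*} [Fintype ι] (d : ι → ℕ) (hpos : ∀ j, 0 < d j)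
    (hd : ∀ j k, j ≠ k → ∀ s : ℚ, (d j : ℚ) ≠ s ^ 2 * d k) (c : ι → ℚ)
    (h : ∑ j, (c j : ℂ) * (Real.sqrt (d j) : ℂ) = 0) : ∀ j, c j = 0 := by
  refine eq_zero_of_sum_ratCast_mul_sqrt_eq_zero_family d hpos hd c ?_
  have h' : ((∑ j, (c j : ℝ) * Real.sqrt (d j) : ℝ) : ℂ) = 0 := by
    push_cast
    rw [← h]
  exact_mod_cast h'

end Literature.NumberTheory.SquareRootsIndependent

end
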